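import Summits.QuantumFields.YangMills.Theorems.CurvatureKernelBound.Negative.WickIntegrand

/-!
# `CurvatureKernelBound` — negative lemmas: the Wick (Gaussian) `n`-point functional of an admissible kernel (family-level witnesses, II)

Supports crux item `stmt-QuantumFields-11687` (`PencilRigidity.CurvatureKernelBound`). Standing disprover's infrastructure
(refuter, cdisprove cycle 3). For an admissible kernel `K` and arity `n ≥ 2`: the Wick sum on `⁰𝒮ₙ`,
`wick K n F = (2^{n/2} (n/2)!)⁻¹ Σ_{σ ∈ Sₙ} ∫ (∏_{i<n/2} K(x_{σ(2i)} − x_{σ(2i+1)})) F(x) dx` for even `n` (`0` for odd `n`)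
— the centred Gaussian `n`-point function with two-point kernel `K`, written through permutations (`K` even; each
perfect matching is counted `2^{n/2}(n/2)!` times) — its seminorm bound `‖wick K n F‖ ≤ n! · Cbn · SNn (4n+1) (5n) F`,
a Hahn–Banach extension to `𝓢((ℝ⁴)ⁿ, ℂ)` dominated by the same seminorm (`S K n hK h`), and `S_eq_wick` on `⁰𝒮ₙ`.
No conclusion below asserts a Theses statement positively. [folklore]
-/

open scoped BigOperators Topology SchwartzMap
open MeasureTheory Filter Set Real
open Literature.MathematicalPhysics.QuantumLattice Literature.MathematicalPhysics.AQFT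

noncomputable section

namespace Summit.QuantumFields.YangMills.Theorems.CurvatureKernelBound.Negative

namespace Wick

open KernelWitness (AdmissibleKernel)
open FlatN (SNn SNn_nonneg)

variable {K : E4 → ℝ} {n : ℕ}

/-! ### The Wick sum on `⁰𝒮ₙ` -/

/-- The Wick normalisation `(2^{n/2} (n/2)!)⁻¹` for even `n`, `0` for odd `n`. [folklore] -/
def wickNorm (n : ℕ) : ℝ := if Even n then ((2 : ℝ) ^ (n / 2) * Nat.factorial (n / 2))⁻¹ else 0

/-- Auxiliary fact `wickNorm_nonneg` (see the module docstring). [folklore] -/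
theorem wickNorm_nonneg (n : ℕ) : 0 ≤ wickNorm n := by
  unfold wickNorm; split_ifs <;> positivity

/-- Auxiliary fact `wickNorm_le_one` (see the module docstring). [folklore] -/
theorem wickNorm_le_one (n : ℕ) : wickNorm n ≤ 1 := by
  unfold wickNorm
  split_ifs
  · refine inv_le_one_of_one_le₀ ?_
    have h1 : (1 : ℝ) ≤ 2 ^ (n / 2) := one_le_pow₀ (by norm_num)
    have h2 : (1 : ℝ) ≤ Nat.factorial (n / 2) := by exact_mod_cast Nat.factorial_pos _
    nlinarith
  · exact zero_le_one

/-- **The Wick sum** (meaningful on `⁰𝒮ₙ`). [folklore] -/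
def wick (K : E4 → ℝ) (n : ℕ) (F : 𝓢((Fin n → E4), ℂ)) : ℂ :=
  (wickNorm n : ℂ) * ∑ σ : Equiv.Perm (Fin n), ∫ x, (wickW K σ x : ℂ) * F x

/-- Auxiliary fact `wick_add` (see the module docstring). [folklore] -/
theorem wick_add (hK : AdmissibleKernel K) (h : 2 ≤ n) {F G : 𝓢((Fin n → E4), ℂ)} (hF : IsOffDiagonal F)
    (hG : IsOffDiagonal G) : wick K n (F + G) = wick K n F + wick K n G := by
  have hFG : ∀ x, (F + G) x = F x + G x := fun _ => rfl
  simp only [wick, hFG, mul_add]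
  rw [← mul_add, ← Finset.sum_add_distrib]
  congr 1
  refine Finset.sum_congr rfl fun σ _ => ?_
  exact integral_add (integrable_wickW_mul hK h σ hF) (integrable_wickW_mul hK h σ hG)

/-- Auxiliary fact `wick_smul` (see the module docstring). [folklore] -/
theorem wick_smul (K : E4 → ℝ) (c : ℂ) (F : 𝓢((Fin n → E4), ℂ)) : wick K n (c • F) = c * wick K n F := by
  have hcF : ∀ x, (c • F) x = c * F x := fun _ => rfl
  simp only [wick, hcF]
  have : ∀ σ : Equiv.Perm (Fin n), ∫ x, (wickW K σ x : ℂ) * (c * F x) = c * ∫ x, (wickW K σ x : ℂ) * F x := by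
    intro σ; rw [← integral_const_mul]; congr 1; funext x; ring
  simp_rw [this, ← Finset.mul_sum]
  ring

/-- The seminorm-bound constant of the Wick sum: `n! · Cbn`. [folklore] -/
def Cw (hK : AdmissibleKernel K) (n : ℕ) : ℝ := Nat.factorial n * Cbn hK n

/-- Auxiliary fact `Cw_nonneg` (see the module docstring). [folklore] -/
theorem Cw_nonneg (hK : AdmissibleKernel K) (n : ℕ) : 0 ≤ Cw hK n :=
  mul_nonneg (by positivity) (Cbn_nonneg hK n)

/-- **Seminorm bound** `‖wick K n F‖ ≤ Cw · SNn (4n+1) (5n) F` on `⁰𝒮ₙ`. [folklore] -/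
theorem norm_wick_le (hK : AdmissibleKernel K) (h : 2 ≤ n) {F : 𝓢((Fin n → E4), ℂ)} (hF : IsOffDiagonal F) :
    ‖wick K n F‖ ≤ Cw hK n * SNn (4 * n + 1) (5 * n) F := by
  unfold wick
  rw [norm_mul, Complex.norm_real, Real.norm_of_nonneg (wickNorm_nonneg n)]
  have hsum : ‖∑ σ : Equiv.Perm (Fin n), ∫ x, (wickW K σ x : ℂ) * F x‖ ≤
      Nat.factorial n * (Cbn hK n * SNn (4 * n + 1) (5 * n) F) := by
    calc ‖∑ σ : Equiv.Perm (Fin n), ∫ x, (wickW K σ x : ℂ) * F x‖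
        ≤ ∑ σ : Equiv.Perm (Fin n), ‖∫ x, (wickW K σ x : ℂ) * F x‖ := norm_sum_le _ _
      _ ≤ ∑ _σ : Equiv.Perm (Fin n), Cbn hK n * SNn (4 * n + 1) (5 * n) F :=
          Finset.sum_le_sum fun σ _ => norm_integral_wickW_mul_le hK h σ hF
      _ = Nat.factorial n * (Cbn hK n * SNn (4 * n + 1) (5 * n) F) := by
          rw [Finset.sum_const, Finset.card_univ, Fintype.card_perm, Fintype.card_fin, nsmul_eq_mul]
  calc wickNorm n * ‖∑ σ : Equiv.Perm (Fin n), ∫ x, (wickW K σ x : ℂ) * F x‖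
      ≤ 1 * (Nat.factorial n * (Cbn hK n * SNn (4 * n + 1) (5 * n) F)) :=
        mul_le_mul (wickNorm_le_one n) hsum (norm_nonneg _) zero_le_one
    _ = Cw hK n * SNn (4 * n + 1) (5 * n) F := by rw [Cw]; ring

/-! ### Hahn–Banach extension -/

/-- `⁰𝒮ₙ` as a `ℂ`-submodule. [folklore] -/
def offDiagN (n : ℕ) : Submodule ℂ 𝓢((Fin n → E4), ℂ) where
  carrier := {F | IsOffDiagonal F}
  add_mem' hF hG := hF.add hG
  zero_mem' := isOffDiagonal_zero
  smul_mem' c _ hF := hF.smul c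

/-- Auxiliary fact `real_smul_eqN` (see the module docstring). [folklore] -/
theorem real_smul_eqN (c : ℝ) (F : 𝓢((Fin n → E4), ℂ)) : c • F = (c : ℂ) • F := by
  ext x; simp

/-- The dominating seminorm `Nw F = Cw · SNn (4n+1) (5n) F`. [folklore] -/
def Nw (hK : AdmissibleKernel K) (n : ℕ) (F : 𝓢((Fin n → E4), ℂ)) : ℝ := Cw hK n * SNn (4 * n + 1) (5 * n) F

/-- Auxiliary fact `Nw_smul` (see the module docstring). [folklore] -/
theorem Nw_smul (hK : AdmissibleKernel K) (c : ℂ) (F : 𝓢((Fin n → E4), ℂ)) :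
    Nw hK n (c • F) = ‖c‖ * Nw hK n F := by
  simp only [Nw, SNn, map_smul_eq_mul]; ring

/-- Auxiliary fact `Nw_add` (see the module docstring). [folklore] -/
theorem Nw_add (hK : AdmissibleKernel K) (F G : 𝓢((Fin n → E4), ℂ)) :
    Nw hK n (F + G) ≤ Nw hK n F + Nw hK n G := by
  simp only [Nw, SNn]
  rw [← mul_add]
  exact mul_le_mul_of_nonneg_left (map_add_le_add _ F G) (Cw_nonneg hK n)

/-- Auxiliary fact `Nw_neg` (see the module docstring). [folklore] -/
theorem Nw_neg (hK : AdmissibleKernel K) (F : 𝓢((Fin n → E4), ℂ)) : Nw hK n (-F) = Nw hK n F := by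
  rw [← neg_one_smul ℂ F, Nw_smul]; simp

/-- The real part of the Wick sum on `⁰𝒮ₙ` as a partially defined real functional. [folklore] -/
def wickR (hK : AdmissibleKernel K) (h : 2 ≤ n) : 𝓢((Fin n → E4), ℂ) →ₗ.[ℝ] ℝ where
  domain := (offDiagN n).restrictScalars ℝ
  toFun :=
    { toFun := fun F => (wick K n F.1).re
      map_add' := fun F G => by
        have hF : IsOffDiagonal F.1 := F.2
        have hG : IsOffDiagonal G.1 := G.2
        simp only [Submodule.coe_add, wick_add hK h hF hG, Complex.add_re]
      map_smul' := fun c F => by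
        simp only [Submodule.coe_smul_of_tower, RingHom.id_apply, smul_eq_mul]
        rw [real_smul_eqN, wick_smul, Complex.re_ofReal_mul] }

/-- Auxiliary fact `wickR_apply` (see the module docstring). [folklore] -/
theorem wickR_apply (hK : AdmissibleKernel K) (h : 2 ≤ n) (F : (wickR hK h).domain) :
    wickR hK h F = (wick K n F.1).re := rfl

/-- Auxiliary fact `exists_extensionN` (see the module docstring). [folklore] -/
theorem exists_extensionN (hK : AdmissibleKernel K) (h : 2 ≤ n) : ∃ g : 𝓢((Fin n → E4), ℂ) →ₗ[ℝ] ℝ,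
    (∀ F : 𝓢((Fin n → E4), ℂ), IsOffDiagonal F → g F = (wick K n F).re) ∧ ∀ F, g F ≤ Nw hK n F := by
  obtain ⟨g, hg1, hg2⟩ := exists_extension_of_le_sublinear (wickR hK h) (Nw hK n)
    (fun c hc F => by rw [real_smul_eqN, Nw_smul, Complex.norm_real, Real.norm_of_nonneg hc.le])
    (Nw_add hK) (fun F => by
      rw [wickR_apply]
      exact (Complex.re_le_norm _).trans (norm_wick_le hK h F.2))
  exact ⟨g, fun F hF => hg1 ⟨F, hF⟩, hg2⟩

/-- The chosen real extension. [folklore] -/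
def gW (hK : AdmissibleKernel K) (h : 2 ≤ n) : 𝓢((Fin n → E4), ℂ) →ₗ[ℝ] ℝ := (exists_extensionN hK h).choose

/-- Auxiliary fact `gW_eq` (see the module docstring). [folklore] -/
theorem gW_eq (hK : AdmissibleKernel K) (h : 2 ≤ n) {F : 𝓢((Fin n → E4), ℂ)} (hF : IsOffDiagonal F) :
    gW hK h F = (wick K n F).re :=
  (exists_extensionN hK h).choose_spec.1 F hF

/-- Auxiliary fact `gW_le` (see the module docstring). [folklore] -/
theorem gW_le (hK : AdmissibleKernel K) (h : 2 ≤ n) (F : 𝓢((Fin n → E4), ℂ)) : gW hK h F ≤ Nw hK n F :=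
  (exists_extensionN hK h).choose_spec.2 F

/-- The complex-linear extension (algebraic). [folklore] -/
def SW (hK : AdmissibleKernel K) (h : 2 ≤ n) : 𝓢((Fin n → E4), ℂ) →ₗ[ℂ] ℂ :=
  Module.Dual.extendRCLike (𝕜 := ℂ) (gW hK h)

/-- Auxiliary fact `norm_SW_le` (see the module docstring). [folklore] -/
theorem norm_SW_le (hK : AdmissibleKernel K) (h : 2 ≤ n) (F : 𝓢((Fin n → E4), ℂ)) :
    ‖SW hK h F‖ ≤ Nw hK n F := by
  have hsq := Module.Dual.norm_extendRCLike_apply_sq (𝕜 := ℂ) (gW hK h) F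
  have h1 : ‖SW hK h F‖ ^ 2 ≤ ‖SW hK h F‖ * Nw hK n F := by
    calc ‖SW hK h F‖ ^ 2 = gW hK h ((starRingEnd ℂ) (SW hK h F) • F) := hsq
      _ ≤ Nw hK n ((starRingEnd ℂ) (SW hK h F) • F) := gW_le hK h _
      _ = ‖SW hK h F‖ * Nw hK n F := by rw [Nw_smul, RCLike.norm_conj]
  by_cases h0 : ‖SW hK h F‖ = 0
  · rw [h0]; exact mul_nonneg (Cw_nonneg hK n) (SNn_nonneg _ _ _)
  · have hpos : 0 < ‖SW hK h F‖ := lt_of_le_of_ne (norm_nonneg _) (Ne.symm h0)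
    rw [sq] at h1
    exact le_of_mul_le_mul_left h1 hpos

/-- Auxiliary fact `SW_eq` (see the module docstring). [folklore] -/
theorem SW_eq (hK : AdmissibleKernel K) (h : 2 ≤ n) {F : 𝓢((Fin n → E4), ℂ)} (hF : IsOffDiagonal F) :
    SW hK h F = wick K n F := by
  have hIF : IsOffDiagonal ((RCLike.I : ℂ) • F) := hF.smul _
  rw [SW, Module.Dual.extendRCLike_apply, gW_eq hK h hF, gW_eq hK h hIF, wick_smul]
  have hI : (RCLike.I : ℂ) = Complex.I := rfl
  rw [hI]
  apply Complex.ext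
  · simp
  · simp

/-- Syntactic bridge to the `Finset.sup` spelling of `mkCLMtoNormedSpace`. [folklore] -/
theorem seminormFamily_eqN :
    schwartzSeminormFamily ℂ (Fin n → E4) ℂ = fun m => SchwartzMap.seminorm ℂ m.1 m.2 := rfl

/-- Auxiliary fact `SNn_le_sup` (see the module docstring). [folklore] -/
theorem SNn_le_sup (F : 𝓢((Fin n → E4), ℂ)) :
    SNn (4 * n + 1) (5 * n) F ≤
      (Finset.Iic ((4 * n + 1 : ℕ), (5 * n : ℕ))).sup (schwartzSeminormFamily ℂ (Fin n → E4) ℂ) F := by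
  rw [seminormFamily_eqN]

set_option maxRecDepth 20000 in
/-- **The extended Wick `n`-point functional** `S K n` (`n ≥ 2`): a continuous linear functional on `𝓢((ℝ⁴)ⁿ, ℂ)` which on
`⁰𝒮ₙ` is the Wick sum. [folklore] -/
def S (hK : AdmissibleKernel K) (h : 2 ≤ n) : 𝓢((Fin n → E4), ℂ) →L[ℂ] ℂ :=
  SchwartzMap.mkCLMtoNormedSpace (𝕜 := ℂ) (σ := RingHom.id ℂ) (SW hK h) (fun F G => map_add (SW hK h) F G)
    (fun c F => by rw [map_smul]; rfl)
    ⟨_, Cw hK n, Cw_nonneg hK n, fun F =>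
      (norm_SW_le hK h F).trans (mul_le_mul_of_nonneg_left (SNn_le_sup F) (Cw_nonneg hK n))⟩

/-- Auxiliary fact `S_apply` (see the module docstring). [folklore] -/
theorem S_apply (hK : AdmissibleKernel K) (h : 2 ≤ n) (F : 𝓢((Fin n → E4), ℂ)) : S hK h F = SW hK h F := rfl

/-- **On `⁰𝒮ₙ` the extension is the Wick sum.** [folklore] -/
theorem S_eq_wick (hK : AdmissibleKernel K) (h : 2 ≤ n) {F : 𝓢((Fin n → E4), ℂ)} (hF : IsOffDiagonal F) :
    S hK h F = wick K n F := by
  rw [S_apply, SW_eq hK h hF]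

end Wick

end Summit.QuantumFields.YangMills.Theorems.CurvatureKernelBound.Negative
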